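import Summits.AnomalousDissipation.AnomalousDissipation.Theorems.SolenoidalFractalHomogenisationLagrangianStepVmodLossAdjPin
import Summits.AnomalousDissipation.AnomalousDissipation.Theorems.SolenoidalFractalHomogenisationLagrangianStepVmodDistortedCorrectedTestBase
import Summits.AnomalousDissipation.AnomalousDissipation.Theorems.SolenoidalFractalHomogenisationLagrangianStepCellEnergyTDualLeak
import Literature.Analysis.FluidPDE.PassiveVectorVarTensorGarding
import HarnessLib

/-!
# K1L_D (stmt-AnomalousDissipation-27980), (ℓ3-A) road A, (S2-adj) glue: the ONSET CORE — the adjoint dissipation density of the coarse member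
# bounded below by EXPLICIT SMOOTH DATA minus the generator remainder `σ·N·‖g‖` (pin trick ∘ base-`s` (D-GEN-J) ∘ duality)
(helper; `--supports 27980 --as helper`; prover ad-k1loc-p3 g12; the composition announced in memo `HOME/ad-k1loc-p3/S2-NOTE-p3g12.md` §2, assembled
from p731106 `EnergyDuhamelG.exists_adjWitness_pin_duality` and p731429 `IsDistortedPropagator.abs_inner_sub_inner_le_of_correctedTest_frameRegular_base`.)

CONVENTION (D28-8′): derivative-index distortion `Torus.Visc4.conj`; constraint `∇·(G v) = 0`.

WHAT.  Cell member `U`, coarse member `T` (drift-free, tensor `𝔸T`, frame `G`), `hED : EnergyDuhamelG Tw 𝔸U 𝔸T bU G U T`, an inverse frame `J`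
with `IsFrameRegular θ Tw nC G J`, a smooth flat-solenoidal field `φ₀`, and the block's corrected test `ζ = [J(t₀)•φ₀]`.  For the pinned adjoint
witness `(Ψ, DΨ)` of `T` at `(t₀, ζ)` and a.e. `σ ∈ (0,t₀)`, for EVERY smooth dual field `χ` and EVERY `λ ≥ 0`:

  `λ·( −⟪[g_σ(χ)], [J(t₀−σ)•φ₀]⟫ − σ·N·‖[g_σ(χ)]‖ ) − λ²·Q_σ(χ) ≤ D(σ)`,

where `g_σ(χ) = 𝓛^{𝔸T^{G(t₀−σ)},*}χ + 𝓛^{(𝔸Tᵀ)^{G(t₀−σ)},*}χ` (smooth, explicit), `Q_σ(χ) = ∫Σ(𝔸Tᵀ)^{G(t₀−σ)}∂χ∂χ`,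
`D(σ) = ∫Σ(𝔸Tᵀ)^{G(t₀−σ)}(DΨ σ)(DΨ σ)` with `lossAdj (T s t₀) ζ = 2∫_{(0,t₀−s]} D`, and `N` is ANY a.e. bound of the corrected generator
`‖J'•φ₀ + 𝓛^{G,*}_{𝔸T}(J•φ₀)‖_{L²}` of the TEST `φ₀` (p727884 `IsFrameRegular.hN_correctedTest` supplies one).  Chain: duality on the witness
(`A_σ(χ) = −∫⟪Ψ σ, g_σ(χ)⟫`), PIN TRANSFER (`= −⟪ζ, T (t₀−σ) t₀ [g_σ(χ)]⟫`: the non-admissible direction is a DATUM of the forward coarse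
propagator), base-`s` (D-GEN-J) with `s = t₀ − σ`, datum `[g_σ(χ)]`, test `J•φ₀`.  What is left to a block prover is REAL ANALYSIS on explicit
smooth integrals: the choice `χ := φ₀`, the evaluation `−⟪g_σ(φ₀), J(t₀−σ)•φ₀⟫ = 2Q_σ(φ₀) + O(θ)` and the size of `N·‖g_σ‖` (FINDING F-p3g12-1:
with the sup-norm `N` this is lossy by `θnC²/|ℓ|²` for low slow modes; the bandwidth tools T1–T3 of the memo repair it), then `two_setIntegral_le_of_le_density`.
* `integral_inner_add_smooth` (bookkeeping; `CellEnergyT.integrable_inner₂`);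
* **`EnergyDuhamelG.exists_adjWitness_onsetCore`** (the statement above, packaged with the witness, its clauses and the loss formula).
`sorry`-free; NOT a proof of any block, of K1L_D or of AD; rung F-D1.A0.
-/

set_option linter.dupNamespace false

noncomputable section

namespace Summit.AnomalousDissipation.AnomalousDissipation.Theorems.SolenoidalFractalHomogenisation.LagrangianStep.VmodDist

open Literature.Analysis Literature.Analysis.FluidPDE Literature.Analysis.FunctionSpaces
open MeasureTheory Set Filter Function
open scoped ENNReal NNReal InnerProductSpace
open Summit.AnomalousDissipation.AnomalousDissipation.Theorems.SolenoidalFractalHomogenisation.LagrangianStep.CellClauseMod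
open Summit.AnomalousDissipation.AnomalousDissipation.Theorems.SolenoidalFractalHomogenisation.LagrangianStep.CellEnergyT

/-! ## §1 Bookkeeping -/

/-- `∫⟪u, g₁⟫ + ∫⟪u, g₂⟫ = ∫⟪u, g₁ + g₂⟫` for `u ∈ L²` and smooth `g₁, g₂`. -/
theorem integral_inner_add_smooth {u g₁ g₂ : VF} (hu : MemLp u 2 volume) (h₁ : Torus.IsSmooth g₁) (h₂ : Torus.IsSmooth g₂) :
    (∫ x, ⟪u x, g₁ x⟫_ℝ) + ∫ x, ⟪u x, g₂ x⟫_ℝ = ∫ x, ⟪u x, g₁ x + g₂ x⟫_ℝ := by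
  rw [← integral_add (integrable_inner₂ hu (h₁.memLp 2)) (integrable_inner₂ hu (h₂.memLp 2))]
  exact integral_congr_ae (Eventually.of_forall fun x => (inner_add_right _ _ _).symm)

/-! ## §2 The onset core -/

variable {Tw θ nC : ℝ} {𝔸U 𝔸T : Torus.Visc4 (Fin 3)} {bU : ℝ → VF} {G J J' : ℝ → UnitAddTorus (Fin 3) → Matrix (Fin 3) (Fin 3) ℝ}
  {U T : ℝ → ℝ → (V2 →L[ℝ] V2)} {φ₀ : VF}

set_option maxHeartbeats 800000 in
/-- **(S2-adj) ONSET CORE.**  See the module docstring.  Hypotheses: the pair binder `hED`, the coarse member as a distorted propagator `hT` with its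
existence clause `hsolT`, the frame class `hG` and the bundled inverse-frame regularity `hR`, full nonnegativity `hQ` of the quadratic form of `𝔸T`,
a smooth flat-solenoidal `φ₀`, the a.e. derivative `hJ'` of `J` and an a.e. generator bound `N` for the corrected test `J•φ₀` along `(0, 𝔸T, G)`.
Conclusion, a.e. in `σ ∈ (0,t₀)`, for every smooth `χ` and `λ ≥ 0`, with `g = 𝓛^{𝔸T^{G(t₀−σ)},*}χ + 𝓛^{(𝔸Tᵀ)^{G(t₀−σ)},*}χ`:
`λ·(−∫⟪g, J(t₀−σ)•φ₀⟫ − σ·N·‖g‖_{L²}) − λ²·Q_σ(χ) ≤ D(σ)`. -/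
theorem EnergyDuhamelG.exists_adjWitness_onsetCore (hED : EnergyDuhamelG Tw 𝔸U 𝔸T bU G U T)
    (hT : IsDistortedPropagator Tw 𝔸T (fun _ _ => 0) G T) (hG : IsFrameModulation θ Tw nC G) (hR : IsFrameRegular θ Tw nC G J)
    (hsolT : ∀ s, 0 ≤ s → s < Tw → ∀ (φ : VF) (hφ : MemLp φ 2 volume), Torus.IsWeaklyDivFree (Torus.distort (G s) φ) → ∃ w : ℝ → VF,
      Torus.IsWeakTensorPassiveVectorDistortedOn 0 (Tw - s) 𝔸T (fun _ _ => 0) (fun τ => G (s + τ)) φ w)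
    (hQ : ∀ ξ : Fin 3 → Fin 3 → ℝ, 0 ≤ ∑ l, ∑ i, ∑ c, ∑ e, 𝔸T i c l e * ξ c i * ξ e l)
    (hφs : Torus.IsSmooth φ₀) (hφdiv : Torus.IsDivFree φ₀)
    (hJ' : ∀ᵐ t ∂(volume.restrict (Ioo 0 Tw)), ∀ y, HasDerivAt (fun s => J s y) (J' t y) t)
    {N : ℝ} (hN0 : 0 ≤ N)
    (hN : ∀ᵐ τ ∂(volume.restrict (Ioo 0 Tw)),
      MemLp (fun x => Torus.distort (J' τ) φ₀ x + Torus.convect (fun _ => 0) (Torus.distort (J τ) φ₀) x +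
          Torus.viscAdjVar (fun y => Torus.Visc4.conj (G τ y) 𝔸T) (Torus.distort (J τ) φ₀) x) 2 volume ∧
      eLpNorm (fun x => Torus.distort (J' τ) φ₀ x + Torus.convect (fun _ => 0) (Torus.distort (J τ) φ₀) x +
          Torus.viscAdjVar (fun y => Torus.Visc4.conj (G τ y) 𝔸T) (Torus.distort (J τ) φ₀) x) 2 volume ≤ ENNReal.ofReal N)
    {t₀ : ℝ} (ht₀ : 0 < t₀) (ht₀T : t₀ ≤ Tw) :
    ∃ (Ψ : ℝ → VF) (DΨ : ℝ → Fin 3 → VF),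
      Torus.IsWeakTensorPassiveVectorDistortedOn 0 t₀ (Torus.majorTranspose 𝔸T) (revCarrier (fun _ _ => 0) t₀) (fun σ => G (t₀ - σ))
        (((((Torus.isSmooth_distort (hR.smooth t₀) hφs).memLp 2).toLp (Torus.distort (J t₀) φ₀) : V2) : V2) : VF) Ψ ∧
      (∀ c, MemLp (uncurry (DΨ · c)) 2 (((volume : Measure ℝ).restrict (Ioo 0 t₀)).prod volume)) ∧
      (∀ᵐ σ ∂(volume.restrict (Ioo 0 t₀)), ∀ c, Torus.HasWeakPartialDeriv c (Ψ σ) (DΨ σ c)) ∧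
      (∀ s ∈ Ico 0 t₀, lossAdj (T s t₀) (((Torus.isSmooth_distort (hR.smooth t₀) hφs).memLp 2).toLp (Torus.distort (J t₀) φ₀)) =
        2 * ∫ σ in Ioc 0 (t₀ - s), ∫ x, ∑ l, ∑ i, ∑ c, ∑ e,
          Torus.Visc4.conj (G (t₀ - σ) x) (Torus.majorTranspose 𝔸T) i c l e * (DΨ σ c x) i * (DΨ σ e x) l) ∧
      ∀ᵐ σ ∂(volume.restrict (Ioo 0 t₀)), ∀ χ : VF, Torus.IsSmooth χ → ∀ lam : ℝ, 0 ≤ lam →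
        lam * (-(∫ x, ⟪Torus.viscAdjVar (fun y => Torus.Visc4.conj (G (t₀ - σ) y) 𝔸T) χ x +
                        Torus.viscAdjVar (fun y => Torus.Visc4.conj (G (t₀ - σ) y) (Torus.majorTranspose 𝔸T)) χ x,
                      Torus.distort (J (t₀ - σ)) φ₀ x⟫_ℝ)
               - σ * N * (eLpNorm (fun x => Torus.viscAdjVar (fun y => Torus.Visc4.conj (G (t₀ - σ) y) 𝔸T) χ x +
                        Torus.viscAdjVar (fun y => Torus.Visc4.conj (G (t₀ - σ) y) (Torus.majorTranspose 𝔸T)) χ x) 2 volume).toReal)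
            - lam ^ 2 * ∫ x, ∑ l, ∑ i, ∑ c, ∑ e, Torus.Visc4.conj (G (t₀ - σ) x) (Torus.majorTranspose 𝔸T) i c l e
                * (Torus.partialDeriv c χ x) i * (Torus.partialDeriv e χ x) l
          ≤ ∫ x, ∑ l, ∑ i, ∑ c, ∑ e,
              Torus.Visc4.conj (G (t₀ - σ) x) (Torus.majorTranspose 𝔸T) i c l e * (DΨ σ c x) i * (DΨ σ e x) l := by
  have hTw : 0 ≤ Tw := ht₀.le.trans ht₀T
  have hGs : ∀ t i j, Torus.IsSmooth (fun y => G t y i j) := fun t i j => hG.smooth_all hTw t i j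
  set ζ : V2 := ((Torus.isSmooth_distort (hR.smooth t₀) hφs).memLp 2).toLp (Torus.distort (J t₀) φ₀) with hζdef
  -- the block's test is `G(t₀)`-solenoidal
  have hζ : Torus.IsWeaklyDivFree (Torus.distort (G t₀) ((ζ : V2) : VF)) :=
    (mem_solClass_iff (fun a c => (hGs t₀ a c).continuous) _).1
      (toLp_mem_solClass_of_isDivFree_distort (hGs t₀) (Torus.isSmooth_distort (hR.smooth t₀) hφs)
        (correctedTest_isDivFree hR.mul_eq_one hφdiv t₀))
  obtain ⟨Ψ, DΨ, hcl, hM, hD, hloss, hae⟩ := hED.exists_adjWitness_pin_duality hT.norm_le hGs hQ ht₀ ht₀T ζ hζ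
  refine ⟨Ψ, DΨ, hcl, hM, hD, hloss, ?_⟩
  filter_upwards [hae, ae_restrict_mem measurableSet_Ioo] with σ hσ hσm χ hχ lam hlam
  obtain ⟨⟨hΨm, _, hpin⟩, _, hdual⟩ := hσ
  -- the smooth field `g = 𝓛₁χ + 𝓛₂χ`
  have h𝔹₁ : ∀ i c l e, Torus.IsSmooth (fun y => Torus.Visc4.conj (G (t₀ - σ) y) 𝔸T i c l e) :=
    fun i c l e => isSmooth_conj_field (hGs (t₀ - σ)) _ i c l e
  have h𝔹₂ : ∀ i c l e, Torus.IsSmooth (fun y => Torus.Visc4.conj (G (t₀ - σ) y) (Torus.majorTranspose 𝔸T) i c l e) :=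
    fun i c l e => isSmooth_conj_field (hGs (t₀ - σ)) _ i c l e
  have hg₁ : Torus.IsSmooth (Torus.viscAdjVar (fun y => Torus.Visc4.conj (G (t₀ - σ) y) 𝔸T) χ) := Torus.isSmooth_viscAdjVar h𝔹₁ hχ
  have hg₂ : Torus.IsSmooth (Torus.viscAdjVar (fun y => Torus.Visc4.conj (G (t₀ - σ) y) (Torus.majorTranspose 𝔸T)) χ) :=
    Torus.isSmooth_viscAdjVar h𝔹₂ hχ
  set g : VF := fun x => Torus.viscAdjVar (fun y => Torus.Visc4.conj (G (t₀ - σ) y) 𝔸T) χ x +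
    Torus.viscAdjVar (fun y => Torus.Visc4.conj (G (t₀ - σ) y) (Torus.majorTranspose 𝔸T)) χ x with hgdef
  have hgs : Torus.IsSmooth g := hg₁.add hg₂
  have hgm : MemLp g 2 volume := hgs.memLp 2
  -- duality on the witness, and the pairing `A_σ(χ) = −∫⟪Ψ σ, g⟫ = −⟪ζ, T (t₀−σ) t₀ [g]⟫`
  have hdu := hdual χ hχ lam
  have hA : -(∫ x, ⟪Ψ σ x, Torus.viscAdjVar (fun y => Torus.Visc4.conj (G (t₀ - σ) y) 𝔸T) χ x⟫_ℝ)
        - ∫ x, ⟪Ψ σ x, Torus.viscAdjVar (fun y => Torus.Visc4.conj (G (t₀ - σ) y) (Torus.majorTranspose 𝔸T)) χ x⟫_ℝ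
      = -⟪T (t₀ - σ) t₀ (hgm.toLp g), ζ⟫_ℝ := by
    rw [real_inner_comm, ← hpin g hgm, ← integral_inner_add_smooth hΨm hg₁ hg₂]
    ring
  -- base-`s` (D-GEN-J) on the coarse member from `s = t₀ − σ` with the datum `[g]`
  have hs : 0 ≤ t₀ - σ := by linarith [hσm.2]
  have hsT : t₀ - σ < Tw := by linarith [hσm.1]
  have key := hT.abs_inner_sub_inner_le_of_correctedTest_frameRegular_base hG hR hsolT hφs hφdiv hJ' hN0 hN hs hsT
    (t := t₀) ⟨by linarith [hσm.1], ht₀T⟩ (hgm.toLp g)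
  have e1 : ⟪hgm.toLp g, ((Torus.isSmooth_distort (hR.smooth (t₀ - σ)) hφs).memLp 2).toLp (Torus.distort (J (t₀ - σ)) φ₀)⟫_ℝ
      = ∫ x, ⟪g x, Torus.distort (J (t₀ - σ)) φ₀ x⟫_ℝ := (integral_inner_eq_inner_toLp hgm _).symm
  have e2 : ‖hgm.toLp g‖ = (eLpNorm g 2 volume).toReal := Lp.norm_toLp _ _
  rw [e1, e2, show t₀ - (t₀ - σ) = σ by ring] at key
  have hle : lam * (-(∫ x, ⟪g x, Torus.distort (J (t₀ - σ)) φ₀ x⟫_ℝ) - σ * N * (eLpNorm g 2 volume).toReal)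
      ≤ lam * (-(∫ x, ⟪Ψ σ x, Torus.viscAdjVar (fun y => Torus.Visc4.conj (G (t₀ - σ) y) 𝔸T) χ x⟫_ℝ)
        - ∫ x, ⟪Ψ σ x, Torus.viscAdjVar (fun y => Torus.Visc4.conj (G (t₀ - σ) y) (Torus.majorTranspose 𝔸T)) χ x⟫_ℝ) := by
    rw [hA]
    refine mul_le_mul_of_nonneg_left ?_ hlam
    have h1 := (abs_sub_le_iff.1 key).1
    linarith
  exact le_trans (by linarith [hle]) hdu

end Summit.AnomalousDissipation.AnomalousDissipation.Theorems.SolenoidalFractalHomogenisation.LagrangianStep.VmodDist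

end
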